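import Mathlib.Topology.Algebra.Group.Basic
import Mathlib.GroupTheory.Index
import Mathlib.GroupTheory.SpecificGroups.Cyclic
import Mathlib.Data.ZMod.Basic
import Mathlib.Tactic.Group

/-!
# Orbicurves of type `(1, l-tors)`, `(1, l-tors)±`, `(1, l-torsΘ)`, `(1, l-torsΘ)±`
# ([EtTh] §2: Def 2.1, Rmk 2.1.1, Prop 2.2, Rmk 2.2.1, Def 2.3, Rmk 2.3.1)

Mochizuki, *The Étale Theta Function …* [EtTh], Publ. RIMS 45 (2009), §2, PRIMS text pp.35–38
(locators `p.N` = PDF pages; bib key `MochizukiEtTh2009`).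

Following plan/FOUNDATIONS.md row 14 ("the IUT use is TYPOLOGICAL … these types are definable as
data on covers without log geometry") the coverings `X̲ → X`, `C̲ → C`, `X̲̲ → X̲`, `C̲̲ → C̲`
(single/double underlines in print) are typed GROUP-THEORETICALLY as open subgroups of the
profinite fundamental group `Π_C` of `C = X/{±1}`, over the interface `ThetaCovers.CoverData l`
transcribing the un-numbered discussion of pp.35–36 (`Π_X ⊆ Π_C`, `G_K`, the mod-`l` theta
quotient `Δ_X ↠ Δ̄_X` with `1 → Δ̄_Θ → Δ̄_X → Δ̄^ell_X → 1`, the decomposition group `D_x` of the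
cusp). The interface lives in the sub-namespace `ThetaCovers` (plan/L2/ASSIGNMENTS §C.4) and is
tagged TODO-merge(abc-iut-L2-t1) (profinite `Π_X`, `C` of Def 1.7) / TODO-merge(abc-iut-L4-t1)
(profinite π₁ with augmentation and cuspidal decomposition groups). ERRATUM (E1, [IUTchI]
Rmk 3.1.6, kurims p.66): "one must in fact assume that the integer `l` is odd in order for the
quotient `Δ̄_X` to be well-defined" — `l` odd is a field of the interface; Remark 2.2.1 (even `l`)
"must be deleted" and is recorded below as a deleted-remark paragraph only.

Not here: Prop 2.4 / 2.6 (characteristic nature of coverings), Def 2.5, 2.7, Cor 2.8, 2.9 — they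
live over the TEMPERED §1 setting (`EtaleTheta.ThetaSetting`, seat abc-iut-L2-t1) in a sibling
file. Nothing here asserts that `CoverData` is inhabited by an actual curve. v3 (interface repair,
plan/GAP-LEDGER G-L2d3-5): the field `CoverData.isOpen_barKer` ("`Ker(Δ_X ↠ Δ̄_X)` open in `Π_C`",
which forces `G_K` finite once `Π_C` is compact) is replaced by `CoverData.isClosed_barKer`; every other
declaration is byte-identical to v2.
-/

namespace Literature.AnabelianGeometry.EtaleTheta

namespace ThetaCovers

universe u

/-- **Interface (pp.35–36)**: a smooth log curve `X^log` of type `(1,1)` over a field `K` of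
characteristic zero, not `K`-arithmetic, seen through the PROFINITE étale fundamental group `Π_C`
of `C^log = X^log/{±1}`: "`1 → Δ_X → Π_X → G_K → 1`" (p.35), `Gal(X/C) ≅ ℤ/2ℤ` (p.36), the quotient
`Δ_X ↠ Δ̄_X` of `Δ^Θ_X = Δ_X/[Δ_X,[Δ_X,Δ_X]]` by `l`-th powers with "`1 → Δ̄_Θ → Δ̄_X → Δ̄^ell_X → 1`,
`Δ̄_Θ ≅ (ℤ/lℤ)(1)`, `Δ̄^ell_X` a free `(ℤ/lℤ)`-module of rank `2`" (p.35), and the decomposition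
group `D_x ⊆ Π_X` of the unique cusp `x`, "which maps the inertia group `I_x ⊆ D_x` isomorphically
onto `Δ̄_Θ`" with "`1 → Δ̄_Θ → D̄_x → G_K → 1`" (p.35). Subgroups of quotients are carried as their
inverse images in `Π_C`. TODO-merge(abc-iut-L2-t1), TODO-merge(abc-iut-L4-t1).
[cite: MochizukiEtTh2009, Def 2.1 p.36] -/
structure CoverData (l : ℕ) : Type (u + 1) where
  /-- ERRATUM E1 ([IUTchI] Rmk 3.1.6): `l` must be odd for `Δ̄_X` to be well-defined -/
  l_odd : Odd l
  /-- `Π_C`, the profinite étale fundamental group of `C^log` (p.36) -/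
  PiC : Type u
  [grp : Group PiC]
  [top : TopologicalSpace PiC]
  [tg : IsTopologicalGroup PiC]
  /-- `G_K = Gal(K̄/K)` (p.35) -/
  GK : Type u
  [grpGK : Group GK]
  /-- `Π_C ↠ G_K` (kernel `Δ_C`, p.36) -/
  aug : PiC →* GK
  /-- `Π_X ⊆ Π_C` (p.36) -/
  PiX : Subgroup PiC
  /-- `X → C` is Galois … -/
  PiX_normal : PiX.Normal
  /-- … with `Gal(X/C) ≅ ℤ/2ℤ` (p.36) -/
  index_PiX : PiX.index = 2
  /-- `Π_X` is open -/
  isOpen_PiX : IsOpen (PiX : Set PiC)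
  /-- `Π_X ↠ G_K` is surjective: "`1 → Δ_X → Π_X → G_K → 1`" (p.35) -/
  aug_PiX_surjective : Function.Surjective (aug.restrict PiX)
  /-- `Ker(Δ_X ↠ Δ̄_X)`, as a subgroup of `Π_C` (p.35) -/
  barKer : Subgroup PiC
  /-- it is normal in `Π_C` (characteristic in `Δ_X`) -/
  barKer_normal : barKer.Normal
  /-- it is closed in `Π_C` (`Δ̄_X` is finite of order `l³`: `Ker(Δ_X ↠ Δ̄_X)` is OPEN IN `Δ_X`, of index
  `l³` — cf. `relIndex_barKer`, `ell_rank_two` — but NOT open in `Π_C`, where `[Π_C : Δ_X] = 2·#G_K` is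
  infinite, p.39 "`K` a finite extension of `ℚ_p`"; v3, GAP-LEDGER G-L2d3-5: the v1/v2 field
  `isOpen_barKer : IsOpen (barKer : Set PiC)` forced `G_K` finite over the compact `Π_C` of
  `TemperedCoverData`, `Discharge/Sec2TemperedCoverDataFiniteGK.lean`) -/
  isClosed_barKer : IsClosed (barKer : Set PiC)
  /-- the inverse image of `Δ̄_Θ ⊆ Δ̄_X` (p.35) -/
  barTheta : Subgroup PiC
  /-- it is normal in `Π_C` -/
  barTheta_normal : barTheta.Normal
  /-- `Ker ⊆ Δ̄_Θ`-preimage … -/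
  barKer_le_barTheta : barKer ≤ barTheta
  /-- … `⊆ Δ_X` -/
  barTheta_le : barTheta ≤ PiX ⊓ aug.ker
  /-- "`Δ̄_Θ ≅ (ℤ/lℤ)(1)`": `Δ̄_Θ` has order `l` (p.35) -/
  relIndex_barKer : barKer.relIndex barTheta = l
  /-- "`Δ̄^ell_X` is a free `(ℤ/lℤ)`-module of rank `2`" (p.35): `Δ_X/Δ̄_Θ-preimage ≅ (ℤ/lℤ)²` -/
  ell_rank_two : Nonempty
    (↥(PiX ⊓ aug.ker) ⧸ barTheta.subgroupOf (PiX ⊓ aug.ker) ≃* Multiplicative (ZMod l × ZMod l))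
  /-- `Δ̄_Θ` is central in `Δ̄_X` (it is the image of `Δ_Θ ⊆` centre of `Δ^Θ_X`, p.35) -/
  barTheta_central : ∀ t ∈ barTheta, ∀ d ∈ PiX ⊓ aug.ker, t * d * t⁻¹ * d⁻¹ ∈ barKer
  /-- `D_x ⊆ Π_X`, the decomposition group of the unique cusp `x` of `X^log` (p.35) -/
  Dx : Subgroup PiC
  /-- `D_x ⊆ Π_X` -/
  Dx_le : Dx ≤ PiX
  /-- "`1 → Δ̄_Θ → D̄_x → G_K → 1`": `D_x ↠ G_K` (the cusp is `K`-rational, p.35) -/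
  aug_Dx_surjective : Function.Surjective (aug.restrict Dx)
  /-- "maps the inertia group `I_x = D_x ∩ Δ_X` isomorphically onto `Δ̄_Θ`" (mod `l`, p.35) -/
  inertia_sup_barKer : (Dx ⊓ aug.ker) ⊔ barKer = barTheta

attribute [instance] CoverData.grp CoverData.top CoverData.tg CoverData.grpGK

namespace CoverData

variable {l : ℕ} (X : CoverData.{u} l)

/-- `Δ_C = Ker(Π_C ↠ G_K)` (p.36). [cite: MochizukiEtTh2009, Def 2.1 p.36] -/
abbrev DeltaC : Subgroup X.PiC := X.aug.ker

/-- `Δ_X = Π_X ∩ Δ_C` (p.35). [cite: MochizukiEtTh2009, Def 2.1 p.36] -/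
abbrev DeltaX : Subgroup X.PiC := X.PiX ⊓ X.aug.ker

/-- **Definition 2.1, the covering `X̲ → X`**: "let `Π̄^ell_X ↠ Q` be a quotient onto a free
`(ℤ/lℤ)`-module `Q` of rank `1` such that the restricted map `Δ̄^ell_X → Q` is still surjective,
but the restricted map `D_x → Q` is trivial. Denote the corresponding covering by `X̲^log → X^log`".
The predicate says: `H = Π_X̲ ⊆ Π_X` is the kernel of such a quotient.
[cite: MochizukiEtTh2009, Def 2.1 p.36] -/
structure IsTypeLTors (H : Subgroup X.PiC) : Prop where
  /-- `Π_X̲ ⊆ Π_X` -/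
  le : H ≤ X.PiX
  /-- `Π_X̲` is the kernel of a surjection `Π_X ↠ Q ≅ ℤ/lℤ` ("free `(ℤ/lℤ)`-module of rank 1") -/
  quot : ∃ φ : X.PiX →* Multiplicative (ZMod l), Function.Surjective φ ∧
    ∀ g : X.PiX, φ g = 1 ↔ (g : X.PiC) ∈ H
  /-- the quotient factors through `Π̄^ell_X`: its kernel contains `Ker(Π_X ↠ Π̄^ell_X) = barTheta` -/
  barTheta_le : X.barTheta ≤ H
  /-- "the restricted map `Δ̄^ell_X → Q` is still surjective": `Δ_X · Π_X̲ = Π_X` -/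
  delta_sup : H ⊔ X.DeltaX = X.PiX
  /-- "the restricted map `D_x → Q` is trivial" -/
  Dx_le : X.Dx ≤ H

/-- **Definition 2.1, the orbicurve `C̲`**: `C̲^log` = stack quotient of `X̲^log` by the inversion `ι̲`
("multiplication by `−1`" relative to a cusp of `X̲`), so `Π_C̲ ⊆ Π_C` contains `Π_X̲` with index `2`
and `Π_C̲ ∩ Π_X = Π_X̲` (cartesian diagram `X̲ → X` over `C̲ → C`, p.36).
[cite: MochizukiEtTh2009, Def 2.1 p.36] -/
structure IsTypeLTorsPm (H' : Subgroup X.PiC) : Prop where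
  /-- `Π_C̲ ∩ Π_X = Π_X̲` is of type `(1, l-tors)` -/
  inf_isTypeLTors : X.IsTypeLTors (H' ⊓ X.PiX)
  /-- `[Π_C̲ : Π_X̲] = 2` -/
  relIndex_two : (H' ⊓ X.PiX).relIndex H' = 2

/-- **Definition 2.1** (type `(1, l-tors)`): "a smooth log orbicurve over `K` that arises, up to
isomorphism, as `X̲^log` for some choice of `Π̄^ell_X ↠ Q`" — as a predicate on open subgroups of
`Π_C`: some `Π_C`-conjugate is a `Π_X̲` (`C` is a `K`-core since `X` is not `K`-arithmetic, p.35,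
so `K`-isomorphism of such covers = isomorphism over `C` = `Π_C`-conjugacy).
[cite: MochizukiEtTh2009, Def 2.1 p.36] -/
def OfTypeLTors (H : Subgroup X.PiC) : Prop :=
  ∃ c : X.PiC, X.IsTypeLTors (H.map (MulAut.conj c).toMonoidHom)

/-- **Definition 2.1** (type `(1, l-tors)±`): arises, up to isomorphism, as `C̲^log`.
[cite: MochizukiEtTh2009, Def 2.1 p.36] -/
def OfTypeLTorsPm (H' : Subgroup X.PiC) : Prop :=
  ∃ c : X.PiC, X.IsTypeLTorsPm (H'.map (MulAut.conj c).toMonoidHom)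

/-- **Remark 2.1.1**: `X̲ → X` is Galois with `Gal(X̲/X) ≅ Q` (immediate: `Π_X̲` is a kernel), but
`C̲ → C` "fails to be Galois in general": "no nontrivial automorphism `∈ Gal(X̲/X)` of odd order
descends to an automorphism of `C̲^log` over `C^log`" [`l` odd ⇒ every element of `Q` has odd
order] — i.e. `N_{Π_C}(Π_C̲) ∩ Π_X = Π_X̲`. [cite: MochizukiEtTh2009, Rmk 2.1.1 p.36] -/
def Rmk211 : Prop :=
  ∀ H' : Subgroup X.PiC, X.IsTypeLTorsPm H' → Subgroup.normalizer (H' : Set X.PiC) ⊓ X.PiX = H' ⊓ X.PiX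

/-- An **inversion** `ι̲ ∈ Δ_C̲`: "an element that lifts the nontrivial element of
`Gal(X̲/C̲) ≅ ℤ/2ℤ`" (p.36). [cite: MochizukiEtTh2009, Prop 2.2 p.36] -/
structure IsInversion (H' : Subgroup X.PiC) (ι : X.PiC) : Prop where
  /-- `ι̲ ∈ Π_C̲` -/
  mem : ι ∈ H'
  /-- `ι̲ ∈ Δ_C` -/
  mem_delta : ι ∈ X.DeltaC
  /-- `ι̲ ∉ Π_X̲`, i.e. it lifts the NONTRIVIAL element of `Gal(X̲/C̲)` -/
  not_mem : ι ∉ X.PiX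

/-! ## Proposition 2.2 (The Inversion Automorphism), `l` odd -/

/-- The data "`Im(s_ι)`" of Prop 2.2 (i): the inverse image `E ⊆ Δ_X̲` of the `(−1)`-eigenspace
`Δ̄^ell_X̲ ⊆ Δ̄_X̲` of `ι̲`, complementary to the `(+1)`-eigenspace `Δ̄_Θ`, stable under
`Π_X̲`-conjugation. [cite: MochizukiEtTh2009, Prop 2.2(i) p.37] -/
structure IsMinusEigen (H H' : Subgroup X.PiC) (ι : X.PiC) (E : Subgroup X.PiC) : Prop where
  /-- `Ker ⊆ E` -/
  barKer_le : X.barKer ≤ E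
  /-- `E ⊆ Δ_X̲` -/
  le : E ≤ H ⊓ X.DeltaC
  /-- "compatible with the conjugation action of `Π_X̲`": `E` is normalised by `Π_X̲` -/
  conj_mem : ∀ g ∈ H, ∀ e ∈ E, g * e * g⁻¹ ∈ E
  /-- direct product decomposition `Δ̄_X̲ = Δ̄^ell_X̲ × Δ̄_Θ`: trivial intersection … -/
  inf_eq : E ⊓ X.barTheta = X.barKer
  /-- … and generation -/
  sup_eq : E ⊔ X.barTheta = H ⊓ X.DeltaC
  /-- `ι̲` acts by `−1` on `E/Ker` … -/
  minus : ∀ e ∈ E, ι * e * ι⁻¹ * e ∈ X.barKer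
  /-- … and by `+1` on `Δ̄_Θ` -/
  plus : ∀ t ∈ X.barTheta, ι * t * ι⁻¹ * t⁻¹ ∈ X.barKer
  /-- normalised by `ι̲` (so `Π_C̲` acts) -/
  iota_conj : ∀ e ∈ E, ι * e * ι⁻¹ ∈ E

/-- **Proposition 2.2 (i)**: for `l` odd, the conjugation action of `ι̲` on the rank-two
`(ℤ/lℤ)`-module `Δ̄_X̲` determines a decomposition `Δ̄_X̲ ≅ Δ̄^ell_X̲ × Δ̄_Θ` into `(−1)`- and
`(+1)`-eigenspaces compatible with `Π_X̲`-conjugation; `s_ι : Δ̄^ell_X̲ → Δ̄_X̲` the resulting splitting.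
[cite: MochizukiEtTh2009, Prop 2.2(i) p.37] -/
def Prop22_i : Prop :=
  ∀ (H H' : Subgroup X.PiC) (ι : X.PiC), X.IsTypeLTorsPm H' → H = H' ⊓ X.PiX →
    X.IsInversion H' ι → ∃! E : Subgroup X.PiC, X.IsMinusEigen H H' ι E

/-- A **splitting of `D̄_x ↠ G_K`** (Prop 2.2 (ii)): a subgroup `S` with `Ker ⊆ S ⊆ D_x · Ker`,
`S ∩ Δ̄_Θ = 1` (mod `Ker`) and `S ↠ G_K`. The set of such is "the `H¹(G_K, Δ̄_Θ) ≅ K^×/(K^×)^l`-torsor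
of splittings" (the torsor structure = Kummer theory, not typed here).
[cite: MochizukiEtTh2009, Prop 2.2(ii) p.37] -/
structure IsSplitting (S : Subgroup X.PiC) : Prop where
  /-- `Ker ⊆ S` -/
  barKer_le : X.barKer ≤ S
  /-- `S ⊆ D_x · Ker` -/
  le : S ≤ X.Dx ⊔ X.barKer
  /-- `S̄ ∩ Δ̄_Θ = 1` -/
  inf_eq : S ⊓ X.barTheta = X.barKer
  /-- `S ↠ G_K` -/
  surj : Function.Surjective (X.aug.restrict S)

/-- **Proposition 2.2 (ii)**: `Im(s_ι)` is normal in `Π̄_{X̲}` (= `IsMinusEigen.conj_mem`) and induces an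
isomorphism `D_x ≅ Π̄_{X̲}/Im(s_ι)` over `G_K` — typed: `D_x · E = Π_{X̲}` (surjectivity) and
`D_x ∩ E ⊆ Ker` (injectivity); a splitting `S` of `D_x ↠ G_K` determines the covering `X̲̲ → X̲`
with `Π_{X̲̲} := S · E`, whose geometric part is `Δ_{X̲̲} = Im(s_ι)` [`= E`] (then
`Δ̄_{X̲} = Δ̄_{X̲̲} · Δ̄_Θ` is `IsMinusEigen.sup_eq`). The printed coset characterisation of the image of
`ι̲` in `Δ_{C̲}/Δ_{X̲̲}` is NOT transcribed here (every lift normalises `Ē` as `Δ̄_{X̲}` is abelian; the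
intended normalised subgroup needs the page image — review of p404132).
[cite: MochizukiEtTh2009, Prop 2.2(ii) p.37] -/
def Prop22_ii : Prop :=
  ∀ (H H' E S : Subgroup X.PiC) (ι : X.PiC), X.IsTypeLTorsPm H' → H = H' ⊓ X.PiX →
    X.IsInversion H' ι → X.IsMinusEigen H H' ι E → X.IsSplitting S →
    X.Dx ⊔ E = H ∧ X.Dx ⊓ E ≤ X.barKer ∧ (S ⊔ E) ⊓ X.DeltaC = E

/-- **Proposition 2.2 (iii)**: there is a unique coset of `Δ̄_{C̲}/Δ̄_{X̲̲}` consisting of the inversions of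
order `2` — ORDER TAKEN IN THE MOD-`l` QUOTIENT `Δ̄_{C̲}`, i.e. `ι̲² ∈ Ker(Δ_X ↠ Δ̄_X)` (the proof on
pp.37–38 works in `Π̄_{C̲}/Δ̄_{X̲̲}`; review of p404132); for such `ι̲`, `Π_{C̲̲} := ⟨Π_{X̲̲}, ι̲⟩` gives a
double covering `X̲̲ → C̲̲` fitting in a cartesian diagram with `X̲ → C̲` (`Π_{C̲̲} ∩ Π_{X̲} = Π_{X̲̲}`).
[cite: MochizukiEtTh2009, Prop 2.2(iii) p.37] -/
def Prop22_iii : Prop :=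
  ∀ (H H' E S : Subgroup X.PiC) (ι : X.PiC), X.IsTypeLTorsPm H' → H = H' ⊓ X.PiX →
    X.IsInversion H' ι → X.IsMinusEigen H H' ι E → X.IsSplitting S →
    (∃ ι₀ : X.PiC, X.IsInversion H' ι₀ ∧ ι₀ * ι₀ ∈ X.barKer ∧
      ∀ ι₁ : X.PiC, X.IsInversion H' ι₁ → (ι₁ * ι₁ ∈ X.barKer ↔ ι₀⁻¹ * ι₁ ∈ E)) ∧
    (ι * ι ∈ X.barKer → ((S ⊔ E) ⊔ Subgroup.zpowers ι) ⊓ H = S ⊔ E ∧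
      (S ⊔ E).relIndex ((S ⊔ E) ⊔ Subgroup.zpowers ι) = 2)

/-! ### Remark 2.2.1 (p.38) — DELETED. "We shall not discuss the case of even `l` in detail …"
(a `2`-torsion observation for `l = 2` used in the proof of Prop 2.12 for `Ċ`). ERRATUM E1,
[IUTchI] Remark 3.1.6 (kurims p.66): "[EtTh], Remark 2.2.1, must be deleted". Recorded as a
deleted-remark paragraph; no declaration. -/

/-! ## Definition 2.3 -/

/-- **Definition 2.3, the covering `X̲̲ → X̲`** constructed in Prop 2.2 (ii): `Π_X̲̲ = S · E` for a
`Π_X̲ ⊆ Π_C̲ ∋ ι̲` of type `(1, l-tors)±`, `E = Im(s_ι)` and a splitting `S` of `D_x ↠ G_K`.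
[cite: MochizukiEtTh2009, Def 2.3 p.38] -/
structure IsTypeLTorsTheta (H2 : Subgroup X.PiC) : Prop where
  /-- the construction data exist -/
  out : ∃ (H' E S : Subgroup X.PiC) (ι : X.PiC), X.IsTypeLTorsPm H' ∧ X.IsInversion H' ι ∧
    X.IsMinusEigen (H' ⊓ X.PiX) H' ι E ∧ X.IsSplitting S ∧ H2 = S ⊔ E

/-- **Definition 2.3, the orbicurve `C̲̲`** of Prop 2.2 (iii): `Π_{C̲̲} = ⟨Π_{X̲̲}, ι̲⟩` with `ι̲` of order `2`
in `Δ̄_{C̲}` (`ι̲² ∈ Ker(Δ_X ↠ Δ̄_X)`). [cite: MochizukiEtTh2009, Def 2.3 p.38] -/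
structure IsTypeLTorsThetaPm (H2' : Subgroup X.PiC) : Prop where
  /-- the construction data exist -/
  out : ∃ (H' E S : Subgroup X.PiC) (ι : X.PiC), X.IsTypeLTorsPm H' ∧ X.IsInversion H' ι ∧
    ι * ι ∈ X.barKer ∧ X.IsMinusEigen (H' ⊓ X.PiX) H' ι E ∧ X.IsSplitting S ∧
    H2' = (S ⊔ E) ⊔ Subgroup.zpowers ι

/-- **Definition 2.3** (type `(1, l-torsΘ)`): "a smooth log orbicurve over `K` that arises, up to
isomorphism, as `X̲̲^log`". [cite: MochizukiEtTh2009, Def 2.3 p.38] -/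
def OfTypeLTorsTheta (H2 : Subgroup X.PiC) : Prop :=
  ∃ c : X.PiC, X.IsTypeLTorsTheta (H2.map (MulAut.conj c).toMonoidHom)

/-- **Definition 2.3** (type `(1, l-torsΘ)±`): arises, up to isomorphism, as `C̲̲^log`.
[cite: MochizukiEtTh2009, Def 2.3 p.38] -/
def OfTypeLTorsThetaPm (H2' : Subgroup X.PiC) : Prop :=
  ∃ c : X.PiC, X.IsTypeLTorsThetaPm (H2'.map (MulAut.conj c).toMonoidHom)

/-! ### Remark 2.3.1 (p.38): the single underline = "extracting a single copy of `ℤ/lℤ`", the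
double underline = "extracting two copies of `ℤ/lℤ`" — commentary; the corresponding index facts
are the THEOREMS `index_typeLTors` / `index_typeLTorsTheta` below (proved from the interface). -/

/-- **Remark 2.3.1** `[Π_X : Π_{X̲}] = l` for `Π_{X̲}` of type `(1, l-tors)` ("extracting a single copy of
`ℤ/lℤ`"), PROVED from `IsTypeLTors.quot` (`l ≠ 0` as `l` is odd).
[cite: MochizukiEtTh2009, Rmk 2.3.1 p.38] -/
theorem index_typeLTors (H : Subgroup X.PiC) (hH : X.IsTypeLTors H) : H.relIndex X.PiX = l := by
  haveI : NeZero l := ⟨by obtain ⟨k, hk⟩ := X.l_odd; omega⟩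
  obtain ⟨φ, hφs, hφk⟩ := hH.quot
  have hker : φ.ker = H.subgroupOf X.PiX := by
    ext g
    rw [MonoidHom.mem_ker, Subgroup.mem_subgroupOf]
    exact hφk g
  change (H.subgroupOf X.PiX).index = l
  rw [← hker, Subgroup.index_ker, MonoidHom.range_eq_top.mpr hφs, Subgroup.card_top,
    Nat.card_eq_fintype_card, Fintype.card_multiplicative, ZMod.card]

/-- `[A·N : A] = [N : A ∩ N]` for a normal subgroup `N` (second isomorphism theorem, index form;
used for Rmk 2.3.1). [cite: MochizukiEtTh2009, Rmk 2.3.1 p.38] -/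
theorem relIndex_sup_eq_relIndex_of_normal {G : Type*} [Group G] (A N : Subgroup G) [N.Normal] :
    A.relIndex (A ⊔ N) = A.relIndex N := by
  rw [Subgroup.relIndex, Subgroup.relIndex, Subgroup.index_eq_card, Subgroup.index_eq_card]
  symm
  apply Nat.card_eq_of_bijective
    (Subgroup.quotientSubgroupOfEmbeddingOfLE A (le_sup_right : N ≤ A ⊔ N))
  refine ⟨(Subgroup.quotientSubgroupOfEmbeddingOfLE A _).injective, ?_⟩
  rintro ⟨x, hx⟩
  have hx' : (x : G) ∈ N ⊔ A := by rw [sup_comm]; exact hx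
  obtain ⟨n, hn, a, ha, hna⟩ := Subgroup.mem_sup_of_normal_left.mp hx'
  refine ⟨QuotientGroup.mk ⟨n, hn⟩, ?_⟩
  rw [Subgroup.quotientSubgroupOfEmbeddingOfLE_apply_mk]
  apply Quotient.sound
  change QuotientGroup.leftRel _ _ _
  rw [QuotientGroup.leftRel_apply, Subgroup.mem_subgroupOf]
  change (n : G)⁻¹ * x ∈ A
  rw [← hna, ← mul_assoc, inv_mul_cancel, one_mul]
  exact ha

/-- **Remark 2.3.1** `[Π_{X̲} : Π_{X̲̲}] = l` ("extracting two copies of `ℤ/lℤ`"; `Π̄_{X̲}/Im(s_ι) ≅ D̄_x` and a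
splitting has index `l = #Δ̄_Θ` in `D̄_x`), PROVED from the interface axioms.
[cite: MochizukiEtTh2009, Rmk 2.3.1 p.38] -/
theorem index_typeLTorsTheta (H' E S : Subgroup X.PiC) (ι : X.PiC) (hH' : X.IsTypeLTorsPm H')
    (hE : X.IsMinusEigen (H' ⊓ X.PiX) H' ι E) (hS : X.IsSplitting S) :
    (S ⊔ E).relIndex (H' ⊓ X.PiX) = l := by
  haveI := X.barTheta_normal
  haveI := X.barKer_normal
  have hT := hH'.inf_isTypeLTors
  have hSle : S ≤ H' ⊓ X.PiX :=
    hS.le.trans (sup_le hT.Dx_le (X.barKer_le_barTheta.trans hT.barTheta_le))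
  have hEle : E ≤ H' ⊓ X.PiX := hE.le.trans inf_le_left
  -- `Π_{X̲} = (S ⊔ E) · Δ̄_Θ`-preimage
  have hH : (S ⊔ E) ⊔ X.barTheta = H' ⊓ X.PiX := by
    refine le_antisymm (sup_le (sup_le hSle hEle) hT.barTheta_le) fun h hh => ?_
    obtain ⟨⟨s, hs⟩, hsh⟩ := hS.surj (X.aug h)
    have hsh : X.aug s = X.aug h := hsh
    have hy : s⁻¹ * h ∈ E ⊔ X.barTheta := by
      rw [hE.sup_eq]
      refine ⟨Subgroup.mul_mem _ (Subgroup.inv_mem _ (hSle hs)) hh, ?_⟩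
      change s⁻¹ * h ∈ X.aug.ker
      rw [MonoidHom.mem_ker, map_mul, map_inv, hsh, inv_mul_cancel]
    have : h = s * (s⁻¹ * h) := by group
    rw [this]
    exact Subgroup.mul_mem _ (Subgroup.mem_sup_left (Subgroup.mem_sup_left hs))
      ((sup_assoc S E X.barTheta).symm ▸ Subgroup.mem_sup_right hy)
  -- `(S ⊔ E) ∩ Δ̄_Θ`-preimage `= Ker`
  have hSE : (S ⊔ E) ⊓ X.barTheta = X.barKer := by
    refine le_antisymm ?_ (le_inf (hS.barKer_le.trans le_sup_left) X.barKer_le_barTheta)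
    rintro x ⟨hxSE, hxT⟩
    haveI : (E.subgroupOf (H' ⊓ X.PiX)).Normal :=
      (Subgroup.normal_subgroupOf_iff hEle).mpr fun e g he hg => hE.conj_mem g hg e he
    have hx' : (⟨x, sup_le hSle hEle hxSE⟩ : ↥(H' ⊓ X.PiX)) ∈
        S.subgroupOf (H' ⊓ X.PiX) ⊔ E.subgroupOf (H' ⊓ X.PiX) := by
      rw [← Subgroup.subgroupOf_sup hSle hEle, Subgroup.mem_subgroupOf]; exact hxSE
    obtain ⟨y, hy, z, hz, hyz⟩ := Subgroup.mem_sup_of_normal_right.mp hx'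
    rw [Subgroup.mem_subgroupOf] at hy hz
    have hxyz : (y : X.PiC) * z = x := congrArg Subtype.val hyz
    have hxΔ : X.aug x = 1 := (X.barTheta_le hxT).2
    have hzΔ : X.aug z = 1 := (hE.le hz).2
    have hyΔ : X.aug y = 1 := by
      have := congrArg X.aug hxyz
      rw [map_mul, hzΔ, mul_one, hxΔ] at this
      exact this
    obtain ⟨d, hd, k, hk, hdk⟩ := Subgroup.mem_sup_of_normal_right.mp (hS.le hy)
    have hdΔ : X.aug d = 1 := by
      have := congrArg X.aug hdk
      rw [map_mul, (X.barTheta_le (X.barKer_le_barTheta hk)).2, mul_one, hyΔ] at this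
      exact this
    have hyT : (y : X.PiC) ∈ X.barTheta := by
      rw [← X.inertia_sup_barKer, ← hdk]
      exact Subgroup.mul_mem _ (Subgroup.mem_sup_left ⟨hd, hdΔ⟩) (Subgroup.mem_sup_right hk)
    have hyK : (y : X.PiC) ∈ X.barKer := by rw [← hS.inf_eq]; exact ⟨hy, hyT⟩
    have hxE : x ∈ E := by
      rw [← hxyz]; exact Subgroup.mul_mem _ (hE.barKer_le hyK) hz
    rw [← hE.inf_eq]; exact ⟨hxE, hxT⟩
  calc (S ⊔ E).relIndex (H' ⊓ X.PiX)
      = (S ⊔ E).relIndex ((S ⊔ E) ⊔ X.barTheta) := by rw [hH]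
    _ = (S ⊔ E).relIndex X.barTheta := relIndex_sup_eq_relIndex_of_normal _ _
    _ = ((S ⊔ E) ⊓ X.barTheta).relIndex X.barTheta := (Subgroup.inf_relIndex_right _ _).symm
    _ = X.barKer.relIndex X.barTheta := by rw [hSE]
    _ = l := X.relIndex_barKer

end CoverData

end ThetaCovers

end Literature.AnabelianGeometry.EtaleTheta
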